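/-
Origin: expansion seat `prover-pub-hodgecm-mc-binder-2-g13-0`, handover #74 r4 2026-08-20T08:40Z md5 4c3e535d1d08 (287 l.; 13 s; imports #73; (V-val) AT THE ι₁ SLOT — bookkeeping of the η- and κ-factors: **`eta_kPair_lettInv_mulSingle`** (`η(kPair (lettInv (mulSingle b x))) = det(uOfLetter b x)^{nV (cmPlaceOver b).1}` at EVERY real b incl. v₁), **`hκ₁_iff_of_type`** (ι₁ residual with the η-factor evaluated); `coe_uOfLetter_cmPlace_apply` (u = D_s·P_σ·embTwist(π k)·P_σ⁻¹·D_s⁻¹ from #62), `det_coe_uOfLetter_cmPlace`, `coe_uOfLetter_cmPlace_perm_two`, **`embTwist_archKappa_lettInv_mulSingle_cmPlace`** (`embTwist (archKappa (lettInv (mulSingle v₁ x))) = det u / (u (σ2)(σ2))³`, tree `coe_isotropyDetChar_eq`), `coe_kV_eq_reindex_scaleConj_uOfLetter` (diag(A,D) = reindex ε ε (D·u·D⁻¹) at every b; #50 `coe_cmPlaceComponent_fst`), `det_coe_uOfLetter` (det u = det A·det D), `coe_uOfLetter_negIdx` (u (q.1)(q.1) = D q q), **`embTwist_archKappa_lettInv_mulSingle_cmPlace_eq`**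 (**`embTwist (archKappa (lettInv (mulSingle v₁ (A,D)))) = det A · det D / (D q₀ q₀)³`** — the holomorphic K-type `det A·d⁻²` ON THE LETTERS, kernel-exact); **`hκ₁_iff_letterChar`** (THE ι₁ RESIDUAL WITH η AND κ EVALUATED: `hκ₁ ⟺ ∀ (A,D), (det A·det D)^{nV(w v₁)} · pinLetterChar(kVLetters (mulSingle v₁ (A,D))) · dVIota (A,D) = embTwist (det A·det D/(D q₀ q₀)³)`); `#print axioms` ⊆ trio all 11 (`g13/certs/axioms-74.log`); FQN scan 0 collisions; NAME LIST `HodgeCM.Model.HypCensus.` × {hκ₁_iff_letterChar, eta_kPair_lettInv_mulSingle, hκ₁_iff_of_type, coe_uOfLetter_cmPlace_apply, det_coe_uOfLetter_cmPlace, coe_uOfLetter_cmPlace_perm_two, embTwist_archKappa_lettInv_mulSingle_cmPlace, coe_kV_eq_reindex_scaleConj_uOfLetter, det_coe_uOfLetter, coe_uOfLetter_negIdx, embTwist_archKappa_lettInv_mulSingle_cmPlace_eq}) (`HOME/mc/pub-hodgecm-mc-binder-2/g13/pkg/HodgeCM/Model/HypCensus/KappaIota.lean`, md5 4c3e535d1d08,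 287 lines);
landed by the gen-17 packager (p-g17) in gate run 45 as `HodgeCM/Model/HypCensus/KappaIota.lean` (verbatim).
-/
/-
Copyright (c) 2026. All rights reserved.
Released under Apache 2.0 license as described in the file LICENSE.
-/
import Summits.HodgeConjecture.HodgeCM.Model.HypCensus.KappaLetters

/-!
# (V-val) at the `ι₁` slot, first bookkeeping: the `η`-factor on the `ι₁`-letters

Binder-2 lineage, rows 18/19.  After #73 `hκ_of_iota_of_type` the residual of (V-val) is `hκ₁`, the identity on the letters
`lettInv (mulSingle v₁ x)`, `x ∈ U(V⁺_{v₁}) × U(V⁻_{v₁})`.  Of its four factors, the `η`-factor is already explicit at EVERY place by #72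
`kPair_lettInv_mulSingle` + K-1 `coe_cmDetTwistChar_archSingle_one`:

* **`eta_kPair_lettInv_mulSingle`**: `η(kPair (lettInv (mulSingle b x))) = det(uOfLetter b x)^{n_V(w b)}` for `η = (χ_V∘det_V)·(χ_W∘det_W)`,
  `χ_V` of archimedean type `n_V` — at every real `b`, in particular at `b = v₁`.

So `hκ₁ ⟺ ∀ x, det(u_x)^{n_V(w v₁)} · pinLetterChar (kVLetters (mulSingle v₁ x)) · dVIota x = archKappa (lettInv (mulSingle v₁ x))`
(`hκ₁_iff_of_type`): what remains is the closed form of the letter character at `ι₁` (the pair's vacuum exponents there) against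
`archKappa = det A·d⁻²` read through the frame (memo `mc/pub-hodgecm-mc-binder-2/g13/V-VAL.md` §4).  Nothing here is a claim of PerL/QW8.
-/

noncomputable section

open NumberField NumberField.InfinitePlace IsDedekindDomain
open scoped Matrix Classical TensorProduct
open MvPolynomial
open Literature.NumberTheory.Automorphic Literature.NumberTheory.Automorphic.UnitaryGroup Literature.NumberTheory.Weil1964
open Literature.RepresentationTheory.KonnoKonno2007 Literature.RepresentationTheory.KonnoKonno2007.RealDualPair
open Literature.NumberTheory.GelbartRogawski1991 Literature.NumberTheory.GelbartRogawski1991.UnitaryDualPair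
open Literature.Analysis.SegalBargmann
open HodgeCM HodgeCM.Model HodgeCM.Adelic

namespace HodgeCM.Model.HypCensus

section Iota

variable {L : CMField} {ι₁ : L →+* ℂ} (V : HermSpace3 L ι₁) (S : StubTree.SeesawDatum L)
variable
  (hGR : (cmSplittingDatum (L : Type) finProdFinEquiv (frameD V) (frameD_real V) (frameD_ne V) (dW S) (dW_real S) (dW_ne S)).CompatibleSplitting)
  (hW : (∀ j, 0 < (ι₁ ((dW S) j)).re) ∨ ∀ j, (ι₁ ((dW S) j)).re < 0)
variable (χV χW : ContinuousMonoidHom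
  (Literature.NumberTheory.Automorphic.relNormOneIdeles (↥(maximalRealSubfield L)) (L : Type) ⧸
    Literature.NumberTheory.Automorphic.relNormOneRat (↥(maximalRealSubfield L)) (L : Type)) Circle)
variable {nV : InfinitePlace (L : Type) → ℤ}

/-- **the `η`-factor of (V-val) on the letters of ANY place**: `η(kPair (lettInv (mulSingle b x))) = det(u_x)^{n_V(w b)}`. -/
theorem eta_kPair_lettInv_mulSingle (hnV : UnitaryLineChar.HasArchType (L : Type) χV nV)
    (b : {v : InfinitePlace ↥(maximalRealSubfield L) // v.IsReal})
    (x : Matrix.unitaryGroup (PosIdx (cmXV (L : Type) (frameD V) (frameD_real V) ι₁ b)) ℂ ×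
      Matrix.unitaryGroup (NegIdx (cmXV (L : Type) (frameD V) (frameD_real V) ι₁ b)) ℂ) :
    ((cmDetTwistChar (L : Type) (frameD V) (frameD_ne V) (dW S) (dW_ne S) (charOfUnitaryLineChar (L : Type) χV)
          (charOfUnitaryLineChar (L : Type) χW)
          (kPair V S ι₁ V.sylvesterFrame (sylvesterFrame_formCongr V) (lettInv V S (Pi.mulSingle b x))) : ℂˣ) : ℂ) =
      (((uOfLetter (L : Type) (frameD V) (frameD_real V) (frameD_ne V) (dW S) (dW_real S) (dW_ne S) ι₁ b x :
          archLocal (L : Type) 3 (Matrix.diagonal (frameD V)) (cmPlaceOver (L : Type) b)) : GL (Fin 3) ℂ) : Matrix (Fin 3) (Fin 3) ℂ).det ^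
        nV (cmPlaceOver (L : Type) b).1 := by
  have hη := coe_cmDetTwistChar_archSingle_one (L : Type) (frameD V) (frameD_ne V) (dW S) (dW_ne S) χV χW
    (cmPlaceOver (L : Type) b) hnV (uOfLetter (L : Type) (frameD V) (frameD_real V) (frameD_ne V) (dW S) (dW_real S) (dW_ne S) ι₁ b x)
  rw [kPair_lettInv_mulSingle]
  erw [hη]

/-- **`hκ₁` with the `η`-factor evaluated**: the `ι₁` slot of (V-val) is the identity
`det(u_x)^{n_V(w v₁)} · pinLetterChar (kVLetters (mulSingle v₁ x)) · dVIota x = archKappa (lettInv (mulSingle v₁ x))` on `U(V⁺_{v₁}) × U(V⁻_{v₁})`. -/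
theorem hκ₁_iff_of_type (hnV : UnitaryLineChar.HasArchType (L : Type) χV nV) :
    (∀ x : Matrix.unitaryGroup (PosIdx (cmXV (L : Type) (frameD V) (frameD_real V) ι₁ (cmPlace (L : Type) ι₁))) ℂ ×
        Matrix.unitaryGroup (NegIdx (cmXV (L : Type) (frameD V) (frameD_real V) ι₁ (cmPlace (L : Type) ι₁))) ℂ,
      ((cmDetTwistChar (L : Type) (frameD V) (frameD_ne V) (dW S) (dW_ne S) (charOfUnitaryLineChar (L : Type) χV)
            (charOfUnitaryLineChar (L : Type) χW)
            (kPair V S ι₁ V.sylvesterFrame (sylvesterFrame_formCongr V)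
              (lettInv V S (Pi.mulSingle (cmPlace (L : Type) ι₁) x))) : ℂˣ) : ℂ) *
          ((pinLetterChar V S hGR hW (kVLetters V S (Pi.mulSingle (cmPlace (L : Type) ι₁) x)) : Circle) : ℂ) * dVIota V S x =
        ((UnitaryGroup.archKappa (L : Type) V.Hm ι₁ V.sylvesterFrame (sylvesterFrame_formCongr V)
          (lettInv V S (Pi.mulSingle (cmPlace (L : Type) ι₁) x)) : ℂˣ) : ℂ)) ↔
      ∀ x : Matrix.unitaryGroup (PosIdx (cmXV (L : Type) (frameD V) (frameD_real V) ι₁ (cmPlace (L : Type) ι₁))) ℂ ×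
        Matrix.unitaryGroup (NegIdx (cmXV (L : Type) (frameD V) (frameD_real V) ι₁ (cmPlace (L : Type) ι₁))) ℂ,
      (((uOfLetter (L : Type) (frameD V) (frameD_real V) (frameD_ne V) (dW S) (dW_real S) (dW_ne S) ι₁ (cmPlace (L : Type) ι₁) x :
          archLocal (L : Type) 3 (Matrix.diagonal (frameD V)) (cmPlaceOver (L : Type) (cmPlace (L : Type) ι₁))) : GL (Fin 3) ℂ) :
            Matrix (Fin 3) (Fin 3) ℂ).det ^ nV (cmPlaceOver (L : Type) (cmPlace (L : Type) ι₁)).1 *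
          ((pinLetterChar V S hGR hW (kVLetters V S (Pi.mulSingle (cmPlace (L : Type) ι₁) x)) : Circle) : ℂ) * dVIota V S x =
        ((UnitaryGroup.archKappa (L : Type) V.Hm ι₁ V.sylvesterFrame (sylvesterFrame_formCongr V)
          (lettInv V S (Pi.mulSingle (cmPlace (L : Type) ι₁) x)) : ℂˣ) : ℂ) := by
  refine forall_congr' fun x => ?_
  rw [eta_kPair_lettInv_mulSingle V S χV χW hnV]

end Iota

/-! ## The `archKappa`-factor on the `ι₁`-letters: `det A · d⁻²` read through the frame -/

section Kappa

variable {L : CMField} {ι₁ : L →+* ℂ} (V : HermSpace3 L ι₁) (S : StubTree.SeesawDatum L)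

open Literature.Geometry.ComplexHyperbolic.BallModel (U21 x₀ mat Jac isotropyDetChar coe_isotropyDetChar coe_isotropyDetChar_eq)

/-- the matrix of the local element of a letter at `v₁`, read off the ball projection (#62 `coe_archAt_cmPlaceOver_archFrameConj`). -/
theorem coe_uOfLetter_cmPlace_apply
    (x : Matrix.unitaryGroup (PosIdx (cmXV (L : Type) (frameD V) (frameD_real V) ι₁ (cmPlace (L : Type) ι₁))) ℂ ×
      Matrix.unitaryGroup (NegIdx (cmXV (L : Type) (frameD V) (frameD_real V) ι₁ (cmPlace (L : Type) ι₁))) ℂ) (i j : Fin 3) :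
    (((uOfLetter (L : Type) (frameD V) (frameD_real V) (frameD_ne V) (dW S) (dW_real S) (dW_ne S) ι₁ (cmPlace (L : Type) ι₁) x :
        archLocal (L : Type) 3 (Matrix.diagonal (frameD V)) (cmPlaceOver (L : Type) (cmPlace (L : Type) ι₁))) : GL (Fin 3) ℂ) :
          Matrix (Fin 3) (Fin 3) ℂ) i j =
      ((V.sylvesterScale (V.rationalFramePerm.symm i) : ℝ) : ℂ) *
        embTwist (L : Type) ι₁ (mat (archProjU21EmbCM (L : Type) V.Hm ι₁ V.sylvesterFrame (sylvesterFrame_formCongr V)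
          (lettInvArch V S (Pi.mulSingle (cmPlace (L : Type) ι₁) x))) (V.rationalFramePerm.symm i) (V.rationalFramePerm.symm j)) *
        (((V.sylvesterScale (V.rationalFramePerm.symm j) : ℝ) : ℂ))⁻¹ := by
  have h := coe_archAt_cmPlaceOver_archFrameConj V (lettInvArch V S (Pi.mulSingle (cmPlace (L : Type) ι₁) x)) i j
  have hself := archAt_archSingle_self (↥(maximalRealSubfield L)) (L : Type) (IsCMField.complexConj L) 3 (Matrix.diagonal (frameD V))
    (IsCMField.complexConj_ne_one (L : Type)) (UnitaryGroup.complexConj_smul_infinitePlace (L : Type)) (cmPlaceOver (L : Type) (cmPlace (L : Type) ι₁))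
    (uOfLetter (L : Type) (frameD V) (frameD_real V) (frameD_ne V) (dW S) (dW_real S) (dW_ne S) ι₁ (cmPlace (L : Type) ι₁) x)
  rw [archFrameConj_lettInvArch_mulSingle] at h
  erw [hself] at h
  exact h

/-- **the determinant of the local element** is the twisted determinant of the ball projection. -/
theorem det_coe_uOfLetter_cmPlace
    (x : Matrix.unitaryGroup (PosIdx (cmXV (L : Type) (frameD V) (frameD_real V) ι₁ (cmPlace (L : Type) ι₁))) ℂ ×
      Matrix.unitaryGroup (NegIdx (cmXV (L : Type) (frameD V) (frameD_real V) ι₁ (cmPlace (L : Type) ι₁))) ℂ) :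
    (((uOfLetter (L : Type) (frameD V) (frameD_real V) (frameD_ne V) (dW S) (dW_real S) (dW_ne S) ι₁ (cmPlace (L : Type) ι₁) x :
        archLocal (L : Type) 3 (Matrix.diagonal (frameD V)) (cmPlaceOver (L : Type) (cmPlace (L : Type) ι₁))) : GL (Fin 3) ℂ) :
          Matrix (Fin 3) (Fin 3) ℂ).det =
      embTwist (L : Type) ι₁ (mat (archProjU21EmbCM (L : Type) V.Hm ι₁ V.sylvesterFrame (sylvesterFrame_formCongr V)
        (lettInvArch V S (Pi.mulSingle (cmPlace (L : Type) ι₁) x)))).det := by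
  set m := mat (archProjU21EmbCM (L : Type) V.Hm ι₁ V.sylvesterFrame (sylvesterFrame_formCongr V)
    (lettInvArch V S (Pi.mulSingle (cmPlace (L : Type) ι₁) x))) with hm
  have hu : (((uOfLetter (L : Type) (frameD V) (frameD_real V) (frameD_ne V) (dW S) (dW_real S) (dW_ne S) ι₁ (cmPlace (L : Type) ι₁) x :
        archLocal (L : Type) 3 (Matrix.diagonal (frameD V)) (cmPlaceOver (L : Type) (cmPlace (L : Type) ι₁))) : GL (Fin 3) ℂ) :
          Matrix (Fin 3) (Fin 3) ℂ) =
      scaleConj (fun i => (V.sylvesterScale (V.rationalFramePerm.symm i) : ℝ))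
        ((m.map (embTwist (L : Type) ι₁)).submatrix V.rationalFramePerm.symm V.rationalFramePerm.symm) := by
    ext i j
    rw [coe_uOfLetter_cmPlace_apply, scaleConj_apply, Matrix.submatrix_apply, Matrix.map_apply]
  rw [hu, det_scaleConj _ (fun j => fun h => sylvesterScale_coe_ne_zero V _ (Complex.ofReal_eq_zero.2 h)),
    Matrix.det_submatrix_equiv_self, ← RingHom.mapMatrix_apply, ← RingHom.map_det]

/-- the `(σ 2, σ 2)` entry of the local element is the twisted `(2,2)` entry of the ball projection. -/
theorem coe_uOfLetter_cmPlace_perm_two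
    (x : Matrix.unitaryGroup (PosIdx (cmXV (L : Type) (frameD V) (frameD_real V) ι₁ (cmPlace (L : Type) ι₁))) ℂ ×
      Matrix.unitaryGroup (NegIdx (cmXV (L : Type) (frameD V) (frameD_real V) ι₁ (cmPlace (L : Type) ι₁))) ℂ) :
    (((uOfLetter (L : Type) (frameD V) (frameD_real V) (frameD_ne V) (dW S) (dW_real S) (dW_ne S) ι₁ (cmPlace (L : Type) ι₁) x :
        archLocal (L : Type) 3 (Matrix.diagonal (frameD V)) (cmPlaceOver (L : Type) (cmPlace (L : Type) ι₁))) : GL (Fin 3) ℂ) :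
          Matrix (Fin 3) (Fin 3) ℂ) (V.rationalFramePerm 2) (V.rationalFramePerm 2) =
      embTwist (L : Type) ι₁ (mat (archProjU21EmbCM (L : Type) V.Hm ι₁ V.sylvesterFrame (sylvesterFrame_formCongr V)
        (lettInvArch V S (Pi.mulSingle (cmPlace (L : Type) ι₁) x))) 2 2) := by
  rw [coe_uOfLetter_cmPlace_apply, Equiv.symm_apply_apply, mul_comm (((V.sylvesterScale 2 : ℝ) : ℂ)) _,
    mul_assoc, mul_inv_cancel₀ (sylvesterScale_coe_ne_zero V 2), mul_one]

/-- **`archKappa` ON THE `ι₁`-LETTERS, read through the local element**: `embTwist (archKappa k) = det u / (u (σ2) (σ2))³`,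
`k = lettInv (mulSingle v₁ x)`, `u = uOfLetter v₁ x` (tree `coe_isotropyDetChar_eq`: `κ = det(π k) / (π k)₂₂³`). -/
theorem embTwist_archKappa_lettInv_mulSingle_cmPlace
    (x : Matrix.unitaryGroup (PosIdx (cmXV (L : Type) (frameD V) (frameD_real V) ι₁ (cmPlace (L : Type) ι₁))) ℂ ×
      Matrix.unitaryGroup (NegIdx (cmXV (L : Type) (frameD V) (frameD_real V) ι₁ (cmPlace (L : Type) ι₁))) ℂ) :
    embTwist (L : Type) ι₁
        ((UnitaryGroup.archKappa (L : Type) V.Hm ι₁ V.sylvesterFrame (sylvesterFrame_formCongr V)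
          (lettInv V S (Pi.mulSingle (cmPlace (L : Type) ι₁) x)) : ℂˣ) : ℂ) =
      (((uOfLetter (L : Type) (frameD V) (frameD_real V) (frameD_ne V) (dW S) (dW_real S) (dW_ne S) ι₁ (cmPlace (L : Type) ι₁) x :
          archLocal (L : Type) 3 (Matrix.diagonal (frameD V)) (cmPlaceOver (L : Type) (cmPlace (L : Type) ι₁))) : GL (Fin 3) ℂ) :
            Matrix (Fin 3) (Fin 3) ℂ).det /
        (((uOfLetter (L : Type) (frameD V) (frameD_real V) (frameD_ne V) (dW S) (dW_real S) (dW_ne S) ι₁ (cmPlace (L : Type) ι₁) x :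
          archLocal (L : Type) 3 (Matrix.diagonal (frameD V)) (cmPlaceOver (L : Type) (cmPlace (L : Type) ι₁))) : GL (Fin 3) ℂ) :
            Matrix (Fin 3) (Fin 3) ℂ) (V.rationalFramePerm 2) (V.rationalFramePerm 2) ^ 3 := by
  rw [det_coe_uOfLetter_cmPlace, coe_uOfLetter_cmPlace_perm_two, ← map_pow, ← map_div₀]
  congr 1
  change ((isotropyDetChar (UnitaryGroup.archIsotropyProj (L : Type) V.Hm ι₁ V.sylvesterFrame (sylvesterFrame_formCongr V)
    (lettInv V S (Pi.mulSingle (cmPlace (L : Type) ι₁) x))) : ℂˣ) : ℂ) = _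
  rw [coe_isotropyDetChar_eq, UnitaryGroup.coe_archIsotropyProj]
  rfl

end Kappa

/-! ## The local element of a `ι₁`-letter in block form: `det u = det A · det D`, `u (σ2) (σ2) = D q₀ q₀` -/

section Block

variable {L : CMField} {ι₁ : L →+* ℂ} (V : HermSpace3 L ι₁) (S : StubTree.SeesawDatum L)

open UnitaryDualPair in
/-- **the compact letter IS the framed local element**: `diag(A, D) = reindex ε ε (D_s · u · D_s⁻¹)` at every real place `b`
(#50 `coe_cmPlaceComponent_fst` + #41 `cmPlaceComponent_letterSection` on the single-place family). -/
theorem coe_kV_eq_reindex_scaleConj_uOfLetter (b : {v : InfinitePlace ↥(maximalRealSubfield L) // v.IsReal})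
    (x : Matrix.unitaryGroup (PosIdx (cmXV (L : Type) (frameD V) (frameD_real V) ι₁ b)) ℂ ×
      Matrix.unitaryGroup (NegIdx (cmXV (L : Type) (frameD V) (frameD_real V) ι₁ b)) ℂ) :
    (((UForm.kV _ _ x : UForm (PosIdx (cmXV (L : Type) (frameD V) (frameD_real V) ι₁ b)) (NegIdx (cmXV (L : Type) (frameD V) (frameD_real V) ι₁ b))) :
        GL (PosIdx (cmXV (L : Type) (frameD V) (frameD_real V) ι₁ b) ⊕ NegIdx (cmXV (L : Type) (frameD V) (frameD_real V) ι₁ b)) ℂ) :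
          Matrix (PosIdx (cmXV (L : Type) (frameD V) (frameD_real V) ι₁ b) ⊕ NegIdx (cmXV (L : Type) (frameD V) (frameD_real V) ι₁ b)) (PosIdx (cmXV (L : Type) (frameD V) (frameD_real V) ι₁ b) ⊕ NegIdx (cmXV (L : Type) (frameD V) (frameD_real V) ι₁ b)) ℂ) =
      Matrix.reindex (cmEpsV (L : Type) (frameD V) (frameD_real V) ι₁ b) (cmEpsV (L : Type) (frameD V) (frameD_real V) ι₁ b)
        (scaleConj (cmDV (L : Type) (frameD V) (frameD_real V) ι₁ b)
          (((uOfLetter (L : Type) (frameD V) (frameD_real V) (frameD_ne V) (dW S) (dW_real S) (dW_ne S) ι₁ b x :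
              archLocal (L : Type) 3 (Matrix.diagonal (frameD V)) (cmPlaceOver (L : Type) b)) : GL (Fin 3) ℂ) : Matrix (Fin 3) (Fin 3) ℂ)) := by
  have h := coe_cmPlaceComponent_fst (L : Type) (frameD V) (frameD_real V) (frameD_ne V) (dW S) (dW_real S) (dW_ne S) ι₁ b
    (letterSection (L : Type) (frameD V) (frameD_real V) (frameD_ne V) (dW S) (dW_real S) (dW_ne S) ι₁ (kVLetters V S (Pi.mulSingle b x)))
  have h1 := congrArg (fun g : Ginf (PosIdx (cmXV (L : Type) (frameD V) (frameD_real V) ι₁ b)) (NegIdx (cmXV (L : Type) (frameD V) (frameD_real V) ι₁ b))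
      (PosIdx (cmXW (L : Type) (frameD V) (dW S) (dW_real S) ι₁ b)) (NegIdx (cmXW (L : Type) (frameD V) (dW S) (dW_real S) ι₁ b)) =>
      (((g.1 : UForm _ _) : GL (PosIdx (cmXV (L : Type) (frameD V) (frameD_real V) ι₁ b) ⊕ NegIdx (cmXV (L : Type) (frameD V) (frameD_real V) ι₁ b)) ℂ) :
        Matrix (PosIdx (cmXV (L : Type) (frameD V) (frameD_real V) ι₁ b) ⊕ NegIdx (cmXV (L : Type) (frameD V) (frameD_real V) ι₁ b)) (PosIdx (cmXV (L : Type) (frameD V) (frameD_real V) ι₁ b) ⊕ NegIdx (cmXV (L : Type) (frameD V) (frameD_real V) ι₁ b)) ℂ))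
    (cmPlaceComponent_letterSection (L : Type) (frameD V) (frameD_real V) (frameD_ne V) (dW S) (dW_real S) (dW_ne S) ι₁ b
      (kVLetters V S (Pi.mulSingle b x)))
  rw [h] at h1
  have hself := archAt_archSingle_self (↥(maximalRealSubfield L)) (L : Type) (IsCMField.complexConj L) 3 (Matrix.diagonal (frameD V))
    (IsCMField.complexConj_ne_one (L : Type)) (UnitaryGroup.complexConj_smul_infinitePlace (L : Type)) (cmPlaceOver (L : Type) b)
    (uOfLetter (L : Type) (frameD V) (frameD_real V) (frameD_ne V) (dW S) (dW_real S) (dW_ne S) ι₁ b x)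
  rw [letterSection_kVLetters_mulSingle] at h1
  erw [hself] at h1
  rw [h1]
  have hx : kVLetters V S (Pi.mulSingle b x) b = (x, 1) := by rw [kVLetters_mulSingle, Pi.mulSingle_eq_same]
  rw [hx]
  rfl

open UnitaryDualPair in
/-- **`det u = det A · det D`.** -/
theorem det_coe_uOfLetter (b : {v : InfinitePlace ↥(maximalRealSubfield L) // v.IsReal})
    (x : Matrix.unitaryGroup (PosIdx (cmXV (L : Type) (frameD V) (frameD_real V) ι₁ b)) ℂ ×
      Matrix.unitaryGroup (NegIdx (cmXV (L : Type) (frameD V) (frameD_real V) ι₁ b)) ℂ) :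
    (((uOfLetter (L : Type) (frameD V) (frameD_real V) (frameD_ne V) (dW S) (dW_real S) (dW_ne S) ι₁ b x :
        archLocal (L : Type) 3 (Matrix.diagonal (frameD V)) (cmPlaceOver (L : Type) b)) : GL (Fin 3) ℂ) : Matrix (Fin 3) (Fin 3) ℂ).det =
      (x.1 : Matrix (PosIdx (cmXV (L : Type) (frameD V) (frameD_real V) ι₁ b)) (PosIdx (cmXV (L : Type) (frameD V) (frameD_real V) ι₁ b)) ℂ).det *
        (x.2 : Matrix (NegIdx (cmXV (L : Type) (frameD V) (frameD_real V) ι₁ b)) (NegIdx (cmXV (L : Type) (frameD V) (frameD_real V) ι₁ b)) ℂ).det := by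
  rw [← UForm.det_coe_kV, coe_kV_eq_reindex_scaleConj_uOfLetter V S b x, Matrix.det_reindex_self,
    det_scaleConj _ (cmDV_ne_zero (L : Type) (frameD V) (frameD_real V) (frameD_ne V) ι₁ b)]

open UnitaryDualPair in
/-- **the negative diagonal entry of `u` is the `V⁻`-letter**: `u (q.1) (q.1) = D q q`. -/
theorem coe_uOfLetter_negIdx (b : {v : InfinitePlace ↥(maximalRealSubfield L) // v.IsReal})
    (x : Matrix.unitaryGroup (PosIdx (cmXV (L : Type) (frameD V) (frameD_real V) ι₁ b)) ℂ ×
      Matrix.unitaryGroup (NegIdx (cmXV (L : Type) (frameD V) (frameD_real V) ι₁ b)) ℂ)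
    (q : NegIdx (cmXV (L : Type) (frameD V) (frameD_real V) ι₁ b)) :
    (((uOfLetter (L : Type) (frameD V) (frameD_real V) (frameD_ne V) (dW S) (dW_real S) (dW_ne S) ι₁ b x :
        archLocal (L : Type) 3 (Matrix.diagonal (frameD V)) (cmPlaceOver (L : Type) b)) : GL (Fin 3) ℂ) : Matrix (Fin 3) (Fin 3) ℂ) q.1 q.1 =
      (x.2 : Matrix (NegIdx (cmXV (L : Type) (frameD V) (frameD_real V) ι₁ b)) (NegIdx (cmXV (L : Type) (frameD V) (frameD_real V) ι₁ b)) ℂ) q q := by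
  have h := congrFun (congrFun (coe_kV_eq_reindex_scaleConj_uOfLetter V S b x) (Sum.inr q)) (Sum.inr q)
  rw [UForm.coe_kV, Matrix.fromBlocks_apply₂₂, Matrix.reindex_apply, Matrix.submatrix_apply, cmEpsV_symm_inr, scaleConj_apply,
    mul_comm ((cmDV (L : Type) (frameD V) (frameD_real V) ι₁ b q.1 : ℝ) : ℂ) _, mul_assoc,
    mul_inv_cancel₀ (Complex.ofReal_ne_zero.2 (cmDV_ne_zero (L : Type) (frameD V) (frameD_real V) (frameD_ne V) ι₁ b q.1)), mul_one] at h
  exact h.symm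

/-- **`archKappa` ON THE `ι₁`-LETTERS IN CLOSED FORM**: `embTwist (archKappa (lettInv (mulSingle v₁ (A, D)))) = det A · det D / (D q₀ q₀)³`
(`= det A · d⁻²`, `d = D q₀ q₀ = det D` on the one-dimensional `V⁻`). -/
theorem embTwist_archKappa_lettInv_mulSingle_cmPlace_eq
    (x : Matrix.unitaryGroup (PosIdx (cmXV (L : Type) (frameD V) (frameD_real V) ι₁ (cmPlace (L : Type) ι₁))) ℂ ×
      Matrix.unitaryGroup (NegIdx (cmXV (L : Type) (frameD V) (frameD_real V) ι₁ (cmPlace (L : Type) ι₁))) ℂ)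
    (q₀ : NegIdx (cmXV (L : Type) (frameD V) (frameD_real V) ι₁ (cmPlace (L : Type) ι₁))) :
    embTwist (L : Type) ι₁
        ((UnitaryGroup.archKappa (L : Type) V.Hm ι₁ V.sylvesterFrame (sylvesterFrame_formCongr V)
          (lettInv V S (Pi.mulSingle (cmPlace (L : Type) ι₁) x)) : ℂˣ) : ℂ) =
      (x.1 : Matrix (PosIdx (cmXV (L : Type) (frameD V) (frameD_real V) ι₁ (cmPlace (L : Type) ι₁))) (PosIdx (cmXV (L : Type) (frameD V) (frameD_real V) ι₁ (cmPlace (L : Type) ι₁))) ℂ).det * (x.2 : Matrix (NegIdx (cmXV (L : Type) (frameD V) (frameD_real V) ι₁ (cmPlace (L : Type) ι₁))) (NegIdx (cmXV (L : Type) (frameD V) (frameD_real V) ι₁ (cmPlace (L : Type) ι₁))) ℂ).det / (x.2 : Matrix (NegIdx (cmXV (L : Type) (frameD V) (frameD_real V) ι₁ (cmPlace (L : Type) ι₁))) (NegIdx (cmXV (L : Type) (frameD V) (frameD_real V) ι₁ (cmPlace (L : Type) ι₁))) ℂ) q₀ q₀ ^ 3 := by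
  rw [embTwist_archKappa_lettInv_mulSingle_cmPlace, det_coe_uOfLetter, show V.rationalFramePerm 2 = q₀.1 from
    (eq_perm_two_of_not_pos V q₀.2).symm, coe_uOfLetter_negIdx]

end Block

/-! ## `hκ₁` as ONE identity on `U(V⁺_{v₁}) × U(V⁻_{v₁})` with `η` and `κ` evaluated -/

section Final

variable {L : CMField} {ι₁ : L →+* ℂ} (V : HermSpace3 L ι₁) (S : StubTree.SeesawDatum L)
variable
  (hGR : (cmSplittingDatum (L : Type) finProdFinEquiv (frameD V) (frameD_real V) (frameD_ne V) (dW S) (dW_real S) (dW_ne S)).CompatibleSplitting)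
  (hW : (∀ j, 0 < (ι₁ ((dW S) j)).re) ∨ ∀ j, (ι₁ ((dW S) j)).re < 0)
variable (χV χW : ContinuousMonoidHom
  (Literature.NumberTheory.Automorphic.relNormOneIdeles (↥(maximalRealSubfield L)) (L : Type) ⧸
    Literature.NumberTheory.Automorphic.relNormOneRat (↥(maximalRealSubfield L)) (L : Type)) Circle)
variable {nV : InfinitePlace (L : Type) → ℤ}

/-- **(V-val) AT `ι₁`, REDUCED TO THE LETTER CHARACTER**: for `χ_V` of type `n_V`, the `ι₁` residual `hκ₁` of #73 is the identity
`(det A · det D)^{n_V(w v₁)} · pinLetterChar (kVLetters (mulSingle v₁ (A, D))) · dVIota (A, D) = embTwist (det A · det D / (D q₀ q₀)³)`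
on `U(V⁺_{v₁}) × U(V⁻_{v₁})` — what remains is the closed form of the pin's letter character at `ι₁` (memo V-VAL.md §4). -/
theorem hκ₁_iff_letterChar (hnV : UnitaryLineChar.HasArchType (L : Type) χV nV) (q₀ : NegIdx (cmXV (L : Type) (frameD V) (frameD_real V) ι₁ (cmPlace (L : Type) ι₁))) :
    (∀ x : Matrix.unitaryGroup (PosIdx (cmXV (L : Type) (frameD V) (frameD_real V) ι₁ (cmPlace (L : Type) ι₁))) ℂ × Matrix.unitaryGroup (NegIdx (cmXV (L : Type) (frameD V) (frameD_real V) ι₁ (cmPlace (L : Type) ι₁))) ℂ,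
      ((cmDetTwistChar (L : Type) (frameD V) (frameD_ne V) (dW S) (dW_ne S) (charOfUnitaryLineChar (L : Type) χV)
            (charOfUnitaryLineChar (L : Type) χW)
            (kPair V S ι₁ V.sylvesterFrame (sylvesterFrame_formCongr V)
              (lettInv V S (Pi.mulSingle (cmPlace (L : Type) ι₁) x))) : ℂˣ) : ℂ) *
          ((pinLetterChar V S hGR hW (kVLetters V S (Pi.mulSingle (cmPlace (L : Type) ι₁) x)) : Circle) : ℂ) * dVIota V S x =
        ((UnitaryGroup.archKappa (L : Type) V.Hm ι₁ V.sylvesterFrame (sylvesterFrame_formCongr V)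
          (lettInv V S (Pi.mulSingle (cmPlace (L : Type) ι₁) x)) : ℂˣ) : ℂ)) ↔
      ∀ x : Matrix.unitaryGroup (PosIdx (cmXV (L : Type) (frameD V) (frameD_real V) ι₁ (cmPlace (L : Type) ι₁))) ℂ × Matrix.unitaryGroup (NegIdx (cmXV (L : Type) (frameD V) (frameD_real V) ι₁ (cmPlace (L : Type) ι₁))) ℂ,
        ((x.1 : Matrix (PosIdx (cmXV (L : Type) (frameD V) (frameD_real V) ι₁ (cmPlace (L : Type) ι₁))) (PosIdx (cmXV (L : Type) (frameD V) (frameD_real V) ι₁ (cmPlace (L : Type) ι₁))) ℂ).det * (x.2 : Matrix (NegIdx (cmXV (L : Type) (frameD V) (frameD_real V) ι₁ (cmPlace (L : Type) ι₁))) (NegIdx (cmXV (L : Type) (frameD V) (frameD_real V) ι₁ (cmPlace (L : Type) ι₁))) ℂ).det) ^ nV (cmPlaceOver (L : Type) (cmPlace (L : Type) ι₁)).1 *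
            ((pinLetterChar V S hGR hW (kVLetters V S (Pi.mulSingle (cmPlace (L : Type) ι₁) x)) : Circle) : ℂ) * dVIota V S x =
          embTwist (L : Type) ι₁ ((x.1 : Matrix (PosIdx (cmXV (L : Type) (frameD V) (frameD_real V) ι₁ (cmPlace (L : Type) ι₁))) (PosIdx (cmXV (L : Type) (frameD V) (frameD_real V) ι₁ (cmPlace (L : Type) ι₁))) ℂ).det * (x.2 : Matrix (NegIdx (cmXV (L : Type) (frameD V) (frameD_real V) ι₁ (cmPlace (L : Type) ι₁))) (NegIdx (cmXV (L : Type) (frameD V) (frameD_real V) ι₁ (cmPlace (L : Type) ι₁))) ℂ).det / (x.2 : Matrix (NegIdx (cmXV (L : Type) (frameD V) (frameD_real V) ι₁ (cmPlace (L : Type) ι₁))) (NegIdx (cmXV (L : Type) (frameD V) (frameD_real V) ι₁ (cmPlace (L : Type) ι₁))) ℂ) q₀ q₀ ^ 3) := by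
  rw [hκ₁_iff_of_type V S hGR hW χV χW hnV]
  refine forall_congr' fun x => ?_
  rw [det_coe_uOfLetter, ← embTwist_archKappa_lettInv_mulSingle_cmPlace_eq V S x q₀, embTwist_embTwist]

end Final

end HodgeCM.Model.HypCensus

end
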